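import Mathlib
import Summits.ValiantsHypothesis.ValiantsHypothesis.Theorems.DivisionGapPerDivisionHardStubSparseRigidCount

/-!
# `DivisionGap.PerCofactorDegreeReduction` (stmt-ValiantsHypothesis-15046), line `Sketch_ideator4`:
the regular hole (stub `stub_regularHole`, N)

Pure combinatorics.  For `2 ≤ D` and `D + 3m ≤ n` we exhibit a `D`-regular `0/1` matrix `u₀` on
`Fin n × Fin n` (all row sums and all column sums equal to `D`) together with

* an EMPTY `m × m` block: injections `er, ec : Fin m → Fin n` (rows `[0, m)`, columns `[m, 2m)`)
  with `u₀ (er a, ec b) = 0`;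
* a MATCHING of the columns off `range ec` into the rows off `range er` inside the support of
  `u₀`: `M₀ j = m + j` for `j < m` and `M₀ j = j` for `j ≥ 2m`, injective on these columns.

The matrix is a circulant: `u₀ (i, j) = 1` iff the shift `i - j` (in `Fin n`, i.e. mod `n`) lies
in the shift set `S = {0} ∪ [k, k + D - 1)` with `k = max m 1`; `|S| = D` and `j ↦ i - j`,
`i ↦ i - j` are bijections of `Fin n` (`Equiv.subLeft`, `Equiv.subRight`), which gives the line
sums.  The block cells `(a, m + b)` have shift `n + a - m - b ∈ [n - 2m + 1, n - 1]`, disjoint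
from `S ⊆ [0, m + D - 2]` because `D + 3m ≤ n`; the matching cells `(m + j, j)` (`j < m`) have
shift `m = k ∈ S`, the cells `(j, j)` have shift `0 ∈ S`.

No definitions in this file. [folklore]
-/

noncomputable section

-- `Summit.ValiantsHypothesis.ValiantsHypothesis.…` is the tree's mandated single-conjunct layout
-- (Sub = Summit), so the duplicated namespace component is intended.
set_option linter.dupNamespace false

open Literature.Computability.AlgebraicComplexity
open Summit.ValiantsHypothesis.ValiantsHypothesis.Theorems.DivisionGapPerDivisionHard
  (rowDegrees_apply colDegrees_apply)

namespace Summit.ValiantsHypothesis.ValiantsHypothesis.Theorems.DivisionGap.PerCofactorDegreeReduction.RegularHole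

/-- **The regular hole.**  For `2 ≤ D` and `D + 3m ≤ n` there is a `D`-regular `0/1` matrix `u₀`
on `Fin n × Fin n` with an empty `m × m` block `er × ec` (`er, ec` injective) and an injective
matching `j ↦ (M₀ j, j)` of the columns off `range ec` into the rows off `range er` inside the
support of `u₀`.  Witness: the circulant of the shift set `{0} ∪ [k, k + D - 1)`, `k = max m 1`,
with the block rows `[0, m)`, block columns `[m, 2m)` and `M₀ j = m + j` (`j < m`), `M₀ j = j`
(`j ≥ 2m`). [folklore] -/
theorem stub_regularHole :
    ∀ (n D m : ℕ), 2 ≤ D → D + 3 * m ≤ n →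
      ∃ u₀ : (Fin n × Fin n) →₀ ℕ,
        (∀ e, u₀ e ≤ 1) ∧ (∀ i, Finsupp.mapDomain Prod.fst u₀ i = D) ∧
        (∀ j, Finsupp.mapDomain Prod.snd u₀ j = D) ∧
        ∃ (er ec : Fin m → Fin n) (M₀ : Fin n → Fin n),
          Function.Injective er ∧ Function.Injective ec ∧
          (∀ a b, u₀ (er a, ec b) = 0) ∧
          (∀ j, (∀ b, ec b ≠ j) → u₀ (M₀ j, j) = 1 ∧ ∀ a, er a ≠ M₀ j) ∧
          (∀ j j', (∀ b, ec b ≠ j) → (∀ b, ec b ≠ j') → M₀ j = M₀ j' → j = j') := by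
  intro n D m hD hn
  haveI : NeZero n := ⟨by omega⟩
  -- the shift parameter `k = max m 1`
  obtain ⟨k, hk⟩ : ∃ k : ℕ, (m = 0 ∧ k = 1) ∨ (1 ≤ m ∧ k = m) := by
    rcases Nat.eq_zero_or_pos m with h | h
    · exact ⟨1, Or.inl ⟨h, rfl⟩⟩
    · exact ⟨m, Or.inr ⟨h, rfl⟩⟩
  -- the shift set `{0} ∪ [k, k + D - 1)` as a subset of `Fin n`
  have h0 : (0 : ℕ) ∉ Finset.Ico k (k + D - 1) := by
    rw [Finset.mem_Ico]
    omega
  have hlt : ∀ s ∈ Finset.cons 0 (Finset.Ico k (k + D - 1)) h0, s < n := by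
    intro s hs
    rw [Finset.mem_cons, Finset.mem_Ico] at hs
    omega
  obtain ⟨S, hScard, hSmem⟩ : ∃ S : Finset (Fin n), S.card = D ∧
      ∀ x : Fin n, x ∈ S ↔ (x : ℕ) = 0 ∨ (k ≤ x ∧ (x : ℕ) < k + D - 1) := by
    refine ⟨(Finset.cons 0 (Finset.Ico k (k + D - 1)) h0).attachFin hlt, ?_, fun x => ?_⟩
    · rw [Finset.card_attachFin, Finset.card_cons, Nat.card_Ico]
      omega
    · rw [Finset.mem_attachFin, Finset.mem_cons, Finset.mem_Ico]
  -- the circulant `u₀ (i, j) = [i - j ∈ S]`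
  obtain ⟨u₀, hu₀⟩ : ∃ u₀ : (Fin n × Fin n) →₀ ℕ,
      ∀ i j, u₀ (i, j) = if i - j ∈ S then 1 else 0 :=
    ⟨Finsupp.equivFunOnFinite.symm fun e => if e.1 - e.2 ∈ S then 1 else 0, fun _ _ => rfl⟩
  have hsumS : ∑ c : Fin n, (if c ∈ S then 1 else 0) = D := by
    rw [Fintype.sum_ite_mem, Finset.sum_const, smul_eq_mul, mul_one, hScard]
  have h01 : ∀ e, u₀ e ≤ 1 := by
    rintro ⟨i, j⟩
    rw [hu₀]
    split_ifs <;> omega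
  have hrow : ∀ i, Finsupp.mapDomain Prod.fst u₀ i = D := by
    intro i
    have h := rowDegrees_apply u₀ i
    change Finsupp.mapDomain Prod.fst u₀ i = ∑ c, u₀ (i, c) at h
    rw [h]
    simp_rw [hu₀]
    have hsum : ∑ c, (if i - c ∈ S then 1 else 0) = ∑ c : Fin n, (if c ∈ S then 1 else 0) :=
      Fintype.sum_equiv (Equiv.subLeft i) _ _ fun _ => rfl
    rw [hsum, hsumS]
  have hcol : ∀ j, Finsupp.mapDomain Prod.snd u₀ j = D := by
    intro j
    rw [colDegrees_apply]
    simp_rw [hu₀]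
    have hsum : ∑ r, (if r - j ∈ S then 1 else 0) = ∑ r : Fin n, (if r ∈ S then 1 else 0) :=
      Fintype.sum_equiv (Equiv.subRight j) _ _ fun _ => rfl
    rw [hsum, hsumS]
  -- block rows `[0, m)`, block columns `[m, 2m)`, matching rows `m + j` (`j < m`) / `j` (`j ≥ 2m`)
  obtain ⟨er, herv⟩ : ∃ er : Fin m → Fin n, ∀ a, (er a : ℕ) = a :=
    ⟨fun a => ⟨a, by omega⟩, fun _ => rfl⟩
  obtain ⟨ec, hecv⟩ : ∃ ec : Fin m → Fin n, ∀ b, (ec b : ℕ) = m + b :=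
    ⟨fun b => ⟨m + b, by omega⟩, fun _ => rfl⟩
  have hMv : ∀ j : Fin n, (if (j : ℕ) < m then m + j else j : ℕ) < n := by
    intro j
    split_ifs <;> omega
  obtain ⟨M₀, hM₀⟩ : ∃ M₀ : Fin n → Fin n, ∀ j, (M₀ j : ℕ) = if (j : ℕ) < m then m + j else j :=
    ⟨fun j => ⟨_, hMv j⟩, fun _ => rfl⟩
  have her : Function.Injective er := fun a a' h => Fin.ext (by
    have hv := congrArg Fin.val h
    rwa [herv, herv] at hv)
  have hec : Function.Injective ec := fun b b' h => Fin.ext (by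
    have hv := congrArg Fin.val h
    rw [hecv, hecv] at hv
    omega)
  -- a column off `range ec` is `< m` or `≥ 2m`
  have hoff : ∀ j : Fin n, (∀ b, ec b ≠ j) → (j : ℕ) < m ∨ 2 * m ≤ (j : ℕ) := by
    intro j hj
    by_contra hcon
    refine hj ⟨(j : ℕ) - m, by omega⟩ (Fin.ext ?_)
    rw [hecv]
    show m + ((j : ℕ) - m) = j
    omega
  refine ⟨u₀, h01, hrow, hcol, er, ec, M₀, her, hec, fun a b => ?_, fun j hj => ?_,
    fun j j' hj hj' hM => ?_⟩
  · -- the block is empty: the shift `n + a - (m + b)` of the cell `(a, m + b)` is off `S`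
    rw [hu₀, if_neg]
    have hltab : er a < ec b := by
      rw [Fin.lt_def, herv, hecv]
      omega
    rw [hSmem, Fin.coe_sub_iff_lt.2 hltab, herv, hecv]
    omega
  · rcases hoff j hj with hjm | hjm
    · -- `j < m`: the cell `(m + j, j)` has shift `m = k ∈ S`, its row is `≥ m`
      have hMj : (M₀ j : ℕ) = m + j := by rw [hM₀, if_pos hjm]
      refine ⟨?_, fun a ha => ?_⟩
      · rw [hu₀, if_pos]
        have hle : j ≤ M₀ j := by
          rw [Fin.le_def, hMj]
          omega
        rw [hSmem, Fin.sub_val_of_le hle, hMj]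
        omega
      · have hv := congrArg Fin.val ha
        rw [herv, hMj] at hv
        omega
    · -- `j ≥ 2m`: the cell `(j, j)` has shift `0 ∈ S`, its row is `≥ 2m ≥ m`
      have hMj : M₀ j = j := Fin.ext (by rw [hM₀, if_neg (by omega)])
      rw [hMj]
      refine ⟨?_, fun a ha => ?_⟩
      · rw [hu₀, if_pos]
        rw [hSmem, Fin.sub_val_of_le le_rfl]
        omega
      · have hv := congrArg Fin.val ha
        rw [herv] at hv
        omega
  · -- injectivity of the matching on the columns off `range ec`
    have hv := congrArg Fin.val hM
    rw [hM₀, hM₀] at hv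
    apply Fin.ext
    rcases hoff j hj with h1 | h1 <;> rcases hoff j' hj' with h2 | h2 <;>
      split_ifs at hv <;> omega

end Summit.ValiantsHypothesis.ValiantsHypothesis.Theorems.DivisionGap.PerCofactorDegreeReduction.RegularHole

end
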